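import Mathlib
import HarnessLib
import Summits.HubbardSuperconductivity.HubbardSuperconductivity.Theorems.KLProgrammeC4aTubeTadpoleValue

/-!
# Route `KLProgramme` — crux C4a, value layer (L3-val): the SIGNED principal-value pairing in the loop angle — an odd vertex difference
# integrates against a Lipschitz weight at the cost of its FIRST MOMENT, not of its (logarithmic) `L¹` norm (memo HOME/hubbard-kl-c4a-1/C4A-PLAN.md §20)

Cell `gate-hubbard-kl`, lane hubbard-kl-c4a-1 (g4); helper for stub (C) `stub_twoLeg_curvature` of `KLRegimeEngineV17F2` (stmt-HubbardSuperconductivity-20437),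
located risk #12 «(C)-VALUE-K0».

WHY.  The value theorem `…C4aTubeTadpoleValue.norm_tubeTadpole_pair_le` needs a dominator of the odd-difference of the ANGULAR AVERAGE
`G⁺_θ(ρ) − G⁻_θ(−ρ) = ∫[J(ρ,ϑ) − J(−ρ,ϑ)]•V⁺ dϑ + ∫ J(−ρ,ϑ)•[V⁺(Φ₀,Φ(ρ,ϑ)) − V⁻(Φ₀,Φ(−ρ,ϑ))] dϑ`.  The Jacobian half is k3c3-p3's
`…C4aLevelDensityRadial` (`jacR`).  For the vertex half a POINTWISE dominator `e(ϑ)` in `L¹(dϑ)` (p573650 §4) is too crude for the second-order bubbles: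
the 2D bubble's direction-dependent degree-0 term makes `‖V(P(ρ,φ)) − V(P(−ρ,φ))‖ ≍ ρ/max(|φ|, ρ, Λ)` near the Cooper angle, whose `L¹` norm is
`ρ·log(1/ρ)` — a `|h|`.  But that term is ODD in the relative angle `φ` about the Cooper angle (central symmetry of the chart + inversion symmetry of the
bubble), and an odd function integrates to zero against the even part of the smooth weight `J(−ρ, ·)`: only `[w(c+φ) − w(c−φ)]·E_odd(φ)` survives,
`≤ 2·L_w·|φ|·a(φ)` — the FIRST MOMENT `∫|φ|·a(φ)`, which is `O(ρ)` with NO logarithm.  This file proves that bookkeeping once, abstractly: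

* §1 `norm_setIntegral_smul_le_of_odd_decomp` — on the symmetric window `(−π, π)` of relative angles: weight `w` with `|w(c+φ)| ≤ W` and
  `|w(c+φ) − w(c−φ)| ≤ 2·L_w·|φ|`, data `E(c+φ) = Eodd φ + Erem φ` with `Eodd(−φ) = −Eodd φ`, `‖Eodd φ‖ ≤ a φ`, then
  `‖∫_{(−π,π)} w(c+φ) • E(c+φ) dφ‖ ≤ L_w·∫_{(−π,π)} |φ|·a(φ) dφ + W·∫_{(−π,π)} ‖Erem φ‖ dφ`;
* §2 `setIntegral_Ioc_two_pi_eq_recentre` — recentring a `2π`-periodic integrand: `∫_{(0,2π]} F(ϑ) dϑ = ∫_{(−π,π)} F(c+φ) dφ`, and the recentred form of §1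
  for the loop-angle integrals of the tube tadpole (`norm_setIntegral_Ioc_smul_le_of_odd_decomp`).

Pure real analysis; nothing is asserted about the Hubbard model (the odd/remainder split of the fat vertex with `n`-free first moment is the (L3-val) datum,
memo §20.3).  References: FST II CPAM 51 (1998) 1133 §3 (the Cooper logarithm is integrable in the angle); BGM 2006 §2.4 [cite: BenfattoGiulianiMastropietro2006].
-/

noncomputable section

namespace Summit.HubbardSuperconductivity.HubbardSuperconductivity.Theorems.C4a

set_option linter.dupNamespace false -- summit = problem name (single-conjunct summit), D-0017

open Real Set MeasureTheory Filter

/-! ## §1 The signed pairing on the symmetric window -/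

section PV

variable {E' : Type*} [NormedAddCommGroup E'] [NormedSpace ℝ E']

/-- **THE PRINCIPAL-VALUE PAIRING.**  Weight `w` bounded by `W` and `L_w`-Lipschitz ACROSS the centre `c` (`|w(c+φ) − w(c−φ)| ≤ 2L_w|φ|`), data split on the
window into an ODD part dominated by `a` and a remainder: the odd part costs only its first moment against the weight's oscillation, the remainder its `L¹`
norm against `W`. -/
theorem norm_setIntegral_smul_le_of_odd_decomp {w : ℝ → ℝ} {E Eodd Erem : ℝ → E'} {a : ℝ → ℝ} {c W Lw : ℝ}
    (hW : ∀ φ ∈ Ioo (-π) π, |w (c + φ)| ≤ W) (hLw : ∀ φ ∈ Ioo (-π) π, |w (c + φ) - w (c - φ)| ≤ 2 * Lw * |φ|)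
    (hsplit : ∀ φ ∈ Ioo (-π) π, E (c + φ) = Eodd φ + Erem φ) (hodd : ∀ φ, Eodd (-φ) = -Eodd φ) (ha : ∀ φ ∈ Ioo (-π) π, ‖Eodd φ‖ ≤ a φ)
    (hwE : IntegrableOn (fun φ => w (c + φ) • E (c + φ)) (Ioo (-π) π)) (hwodd : IntegrableOn (fun φ => w (c + φ) • Eodd φ) (Ioo (-π) π))
    (hma : IntegrableOn (fun φ => |φ| * a φ) (Ioo (-π) π)) (hrem : IntegrableOn (fun φ => ‖Erem φ‖) (Ioo (-π) π)) :
    ‖∫ φ in Ioo (-π) π, w (c + φ) • E (c + φ)‖ ≤ Lw * (∫ φ in Ioo (-π) π, |φ| * a φ) + W * ∫ φ in Ioo (-π) π, ‖Erem φ‖ := by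
  -- split the data
  have hwrem : IntegrableOn (fun φ => w (c + φ) • Erem φ) (Ioo (-π) π) := by
    have h := hwE.sub hwodd
    refine h.congr_fun (fun φ hφ => ?_) measurableSet_Ioo
    simp only [Pi.sub_apply, hsplit φ hφ, smul_add, add_sub_cancel_left]
  have hsplitI : (∫ φ in Ioo (-π) π, w (c + φ) • E (c + φ)) =
      (∫ φ in Ioo (-π) π, w (c + φ) • Eodd φ) + ∫ φ in Ioo (-π) π, w (c + φ) • Erem φ := by
    rw [← integral_add hwodd hwrem]
    refine setIntegral_congr_fun measurableSet_Ioo fun φ hφ => ?_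
    simp only [hsplit φ hφ, smul_add]
  -- the odd part pairs `φ ↔ −φ`
  have hneg : IntegrableOn (fun φ => w (c - φ) • Eodd φ) (Ioo (-π) π) := by
    have A : MeasurableEmbedding fun x : ℝ => -x := (Homeomorph.neg ℝ).isClosedEmbedding.measurableEmbedding
    have h1 : IntegrableOn (fun φ => w (c + -φ) • Eodd (-φ)) (Ioo (-π) π) := by
      have := (A.integrableOn_map_iff (μ := volume) (f := fun φ => w (c + φ) • Eodd φ) (s := Ioo (-π) π)).1
      rw [Measure.map_neg_eq_self (volume : Measure ℝ)] at this
      have h2 := this hwodd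
      rw [neg_preimage, neg_Ioo, neg_neg] at h2
      exact h2
    have h3 : IntegrableOn (fun φ => -(w (c + -φ) • Eodd (-φ))) (Ioo (-π) π) := h1.neg
    refine h3.congr_fun (fun φ _ => ?_) measurableSet_Ioo
    simp only [hodd φ, smul_neg, neg_neg, ← sub_eq_add_neg]
  have hpair : (∫ φ in Ioo (-π) π, w (c + φ) • Eodd φ) = (1 / 2 : ℝ) • ∫ φ in Ioo (-π) π, (w (c + φ) - w (c - φ)) • Eodd φ := by
    have hsymm : (∫ φ in Ioo (-π) π, w (c + φ) • Eodd φ) = ∫ φ in Ioo (-π) π, -(w (c - φ) • Eodd φ) := by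
      rw [← setIntegral_Ioo_symm_comp_neg π (fun φ => w (c + φ) • Eodd φ)]
      refine setIntegral_congr_fun measurableSet_Ioo fun φ _ => ?_
      simp only [hodd φ, smul_neg, ← sub_eq_add_neg]
    have h2 : (∫ φ in Ioo (-π) π, w (c + φ) • Eodd φ) + (∫ φ in Ioo (-π) π, w (c + φ) • Eodd φ) =
        ∫ φ in Ioo (-π) π, (w (c + φ) - w (c - φ)) • Eodd φ := by
      have hneg' : IntegrableOn (fun φ => -(w (c - φ) • Eodd φ)) (Ioo (-π) π) := hneg.neg
      conv_lhs => arg 2; rw [hsymm]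
      rw [← integral_add hwodd hneg']
      refine setIntegral_congr_fun measurableSet_Ioo fun φ _ => ?_
      rw [sub_smul]
      abel
    rw [← two_smul ℝ (∫ φ in Ioo (-π) π, w (c + φ) • Eodd φ)] at h2
    rw [← h2, smul_smul]
    norm_num
  -- bound the odd part
  have hodd_le : ‖∫ φ in Ioo (-π) π, w (c + φ) • Eodd φ‖ ≤ Lw * (∫ φ in Ioo (-π) π, |φ| * a φ) := by
    rw [hpair, norm_smul, Real.norm_eq_abs, abs_of_pos (by norm_num : (0 : ℝ) < 1 / 2)]
    have hb : ‖∫ φ in Ioo (-π) π, (w (c + φ) - w (c - φ)) • Eodd φ‖ ≤ ∫ φ in Ioo (-π) π, 2 * Lw * (|φ| * a φ) := by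
      refine (norm_integral_le_integral_norm _).trans (integral_mono_of_nonneg (Eventually.of_forall fun φ => norm_nonneg _)
        (hma.const_mul (2 * Lw)) ?_)
      filter_upwards [ae_restrict_mem measurableSet_Ioo] with φ hφ
      rw [norm_smul, Real.norm_eq_abs]
      calc |w (c + φ) - w (c - φ)| * ‖Eodd φ‖ ≤ (2 * Lw * |φ|) * a φ :=
            mul_le_mul (hLw φ hφ) (ha φ hφ) (norm_nonneg _) ((abs_nonneg _).trans (hLw φ hφ))
        _ = 2 * Lw * (|φ| * a φ) := by ring
    rw [integral_const_mul] at hb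
    calc 1 / 2 * ‖∫ φ in Ioo (-π) π, (w (c + φ) - w (c - φ)) • Eodd φ‖ ≤ 1 / 2 * (2 * Lw * ∫ φ in Ioo (-π) π, |φ| * a φ) :=
          mul_le_mul_of_nonneg_left hb (by norm_num)
      _ = Lw * ∫ φ in Ioo (-π) π, |φ| * a φ := by ring
  -- bound the remainder
  have hrem_le : ‖∫ φ in Ioo (-π) π, w (c + φ) • Erem φ‖ ≤ W * ∫ φ in Ioo (-π) π, ‖Erem φ‖ := by
    have hb : ‖∫ φ in Ioo (-π) π, w (c + φ) • Erem φ‖ ≤ ∫ φ in Ioo (-π) π, W * ‖Erem φ‖ := by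
      refine (norm_integral_le_integral_norm _).trans (integral_mono_of_nonneg (Eventually.of_forall fun φ => norm_nonneg _)
        (hrem.const_mul W) ?_)
      filter_upwards [ae_restrict_mem measurableSet_Ioo] with φ hφ
      rw [norm_smul, Real.norm_eq_abs]
      exact mul_le_mul_of_nonneg_right (hW φ hφ) (norm_nonneg _)
    rwa [integral_const_mul] at hb
  rw [hsplitI]
  exact (norm_add_le _ _).trans (add_le_add hodd_le hrem_le)

end PV

/-! ## §2 Recentring the loop-angle window -/

section Recentre

variable {E' : Type*} [NormedAddCommGroup E'] [NormedSpace ℝ E']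

/-- **Recentring a `2π`-periodic loop-angle integrand**: `∫_{(0,2π]} F(ϑ) dϑ = ∫_{(−π,π)} F(c + φ) dφ` for every centre `c`. -/
theorem setIntegral_Ioc_two_pi_eq_recentre {F : ℝ → E'} (hper : Function.Periodic F (2 * π)) (c : ℝ) :
    ∫ ϑ in Ioc 0 (2 * π), F ϑ = ∫ φ in Ioo (-π) π, F (c + φ) := by
  have h1 : ∫ ϑ in Ioc 0 (2 * π), F ϑ = ∫ ϑ in (0 : ℝ)..(0 + 2 * π), F ϑ := by
    rw [intervalIntegral.integral_of_le (by positivity), zero_add]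
  have h2 : ∫ ϑ in (0 : ℝ)..(0 + 2 * π), F ϑ = ∫ ϑ in (c - π)..(c - π + 2 * π), F ϑ :=
    hper.intervalIntegral_add_eq 0 (c - π)
  have h3 : ∫ ϑ in (c - π)..(c - π + 2 * π), F ϑ = ∫ φ in (-π)..π, F (c + φ) := by
    rw [show c - π + 2 * π = c + π by ring]
    have := intervalIntegral.integral_comp_add_left (f := F) (a := -π) (b := π) c
    -- `∫ φ in -π..π, F (c + φ) = ∫ ϑ in c + -π .. c + π, F ϑ`
    rw [this, show c + -π = c - π by ring]
  rw [h1, h2, h3, intervalIntegral.integral_of_le (by linarith [Real.pi_pos]), integral_Ioc_eq_integral_Ioo]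

/-- **The loop-angle form of the PV pairing**: for a `2π`-periodic, locally integrable integrand `ϑ ↦ w(ϑ) • E(ϑ)` whose data split about the centre `c`
as in §1, `‖∫_{(0,2π]} w(ϑ) • E(ϑ) dϑ‖ ≤ L_w·∫_{(−π,π)} |φ|·a(φ) dφ + W·∫_{(−π,π)} ‖Erem φ‖ dφ`. -/
theorem norm_setIntegral_Ioc_smul_le_of_odd_decomp {w : ℝ → ℝ} {E Eodd Erem : ℝ → E'} {a : ℝ → ℝ} {c W Lw : ℝ}
    (hper : Function.Periodic (fun ϑ => w ϑ • E ϑ) (2 * π)) (hII : ∀ s t, IntervalIntegrable (fun ϑ => w ϑ • E ϑ) volume s t)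
    (hW : ∀ φ ∈ Ioo (-π) π, |w (c + φ)| ≤ W) (hLw : ∀ φ ∈ Ioo (-π) π, |w (c + φ) - w (c - φ)| ≤ 2 * Lw * |φ|)
    (hsplit : ∀ φ ∈ Ioo (-π) π, E (c + φ) = Eodd φ + Erem φ) (hodd : ∀ φ, Eodd (-φ) = -Eodd φ) (ha : ∀ φ ∈ Ioo (-π) π, ‖Eodd φ‖ ≤ a φ)
    (hwodd : IntegrableOn (fun φ => w (c + φ) • Eodd φ) (Ioo (-π) π))
    (hma : IntegrableOn (fun φ => |φ| * a φ) (Ioo (-π) π)) (hrem : IntegrableOn (fun φ => ‖Erem φ‖) (Ioo (-π) π)) :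
    ‖∫ ϑ in Ioc 0 (2 * π), w ϑ • E ϑ‖ ≤ Lw * (∫ φ in Ioo (-π) π, |φ| * a φ) + W * ∫ φ in Ioo (-π) π, ‖Erem φ‖ := by
  rw [setIntegral_Ioc_two_pi_eq_recentre hper c]
  have hwE : IntegrableOn (fun φ => w (c + φ) • E (c + φ)) (Ioo (-π) π) := by
    have h := (hII (c + -π) (c + π))
    rw [intervalIntegrable_iff_integrableOn_Ioo_of_le (by linarith [Real.pi_pos])] at h
    -- translate the window
    have A : MeasurePreserving (fun φ : ℝ => c + φ) (volume : Measure ℝ) (volume : Measure ℝ) := measurePreserving_add_left (volume : Measure ℝ) c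
    have hme : MeasurableEmbedding (fun φ : ℝ => c + φ) := (Homeomorph.addLeft c : ℝ ≃ₜ ℝ).measurableEmbedding
    have h2 := (A.integrableOn_comp_preimage hme (f := fun ϑ => w ϑ • E ϑ) (s := Ioo (c + -π) (c + π))).2
    have hpre : (fun φ : ℝ => c + φ) ⁻¹' Ioo (c + -π) (c + π) = Ioo (-π) π := by
      ext φ; simp only [mem_preimage, mem_Ioo]; constructor <;> intro h <;> constructor <;> linarith [h.1, h.2]
    have h3 := h2 h
    rw [hpre] at h3
    exact h3
  exact norm_setIntegral_smul_le_of_odd_decomp hW hLw hsplit hodd ha hwE hwodd hma hrem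

end Recentre

end Summit.HubbardSuperconductivity.HubbardSuperconductivity.Theorems.C4a

end
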